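import Summits.CriticalPhenomena.PercolationContinuityZ3.Theorems.PercNearOneGluingNoHeavyLowerTailSunflowerTwoCoinPairwiseModel

/-!
# (RES0′) for every number of petals on FACE-COMONOTONE families (second model corollary of THEOREM Y)

Same setting as `res0_pairwise` (prove-1 gen 55).  A family is FACE-COMONOTONE if the relative Ȳ-face excess and the relative H-face
excess are ordered the same way in every petal: either `(Ȳ_j − b_Ȳ)/b_Ȳ ≥ (H_j − b_H)/b_H` for all `j` (Ȳ-leaning: x-hubs, k-hubs,
y-petals, …) or `≤` for all `j` (H-leaning: h-petals, dwarfs, H-hubs, …).  Such pairs are two-coin compatible by `same_side_compat`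
(Chebyshev on the three-atom space), so `res0_pairwise` gives `∏ G_j ≤ g^(|S|−1)(c₀+p+q)` from the two face budgets, any `c₀ ≥ 0`.
Together with `res0_Hdominant` this leaves, for the all-`n` problem, exactly the families containing a strongly Ȳ-heavy AND a strongly
H-heavy petal (an incompatible pair). [this work]
-/

namespace Summit.CriticalPhenomena.PercolationContinuityZ3.Theorems.SunflowerPartition.SafeCalc.LinkedCurrency

open Finset

set_option maxHeartbeats 400000 in
/-- **(RES0′) ∀n for Ȳ-leaning families**: every petal has `b_H(Ȳ_j − b_Ȳ) ≥ b_Ȳ(H_j − b_H)`. [this work] -/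
theorem res0_Yleaning {κ : Type*} [DecidableEq κ] {τ σ s α00 α01 α11 c0 : ℝ} (hτ0 : 0 < τ) (hτ1 : τ < 1)
    (hσ0 : 0 ≤ σ) (hσ1 : σ < 1) (hs0 : 0 < s) (hs1 : s ≤ 1) (hα00 : 0 < α00) (h01 : α00 ≤ α01) (h11 : α01 ≤ α11) (hc0 : 0 ≤ c0)
    (S : Finset κ) (hS : S.Nonempty) (y k gc h : κ → ℝ)
    (hy : ∀ j ∈ S, α00 ≤ y j) (hk : ∀ j ∈ S, α01 ≤ k j) (hg : ∀ j ∈ S, α01 ≤ gc j) (hh : ∀ j ∈ S, α11 ≤ h j)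
    (hlean : ∀ j ∈ S, ((1 - s) * α00 + s * α01) * ((1 - σ) * gc j + σ * h j - ((1 - σ) * α01 + σ * α11)) ≤
      ((1 - σ) * α01 + σ * α11) * ((1 - s) * y j + s * k j - ((1 - s) * α00 + s * α01)))
    (hBY : ∏ j ∈ S, ((1 - s) * y j + s * k j) ≤ ((1 - s) * α00 + s * α01) ^ (S.card - 1))
    (hBH : ∏ j ∈ S, ((1 - σ) * gc j + σ * h j) ≤ ((1 - σ) * α01 + σ * α11) ^ (S.card - 1)) :
    ∏ j ∈ S, (c0 + τ * (1 - σ) * ((1 - s) * y j + s * k j) + s * (1 - τ) * ((1 - σ) * gc j + σ * h j)) ≤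
      (c0 + τ * (1 - σ) * ((1 - s) * α00 + s * α01) + s * (1 - τ) * ((1 - σ) * α01 + σ * α11)) ^ (S.card - 1) *
        (c0 + τ * (1 - σ) + s * (1 - τ)) := by
  have hα01 : 0 < α01 := lt_of_lt_of_le hα00 h01
  have hα11 : 0 < α11 := lt_of_lt_of_le hα01 h11
  have hp0 : 0 < τ * (1 - σ) := mul_pos hτ0 (by linarith)
  have hq0 : 0 < s * (1 - τ) := mul_pos hs0 (by linarith)
  have hbY0 : 0 < (1 - s) * α00 + s * α01 := by nlinarith [mul_nonneg (sub_nonneg.2 hs1) hα00.le, mul_pos hs0 hα01]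
  have hbH0 : 0 < (1 - σ) * α01 + σ * α11 := by nlinarith [mul_pos (sub_pos.2 hσ1) hα01, mul_nonneg hσ0 hα11.le]
  refine res0_pairwise hτ0 hτ1 hσ0 hσ1 hs0 hs1 hα00 h01 h11 hc0 S hS y k gc h hy hk hg hh ?_ hBY hBH
  intro i hi j hj _
  obtain ⟨bY, hbY⟩ : ∃ b, b = (1 - s) * α00 + s * α01 := ⟨_, rfl⟩
  obtain ⟨bH, hbH⟩ : ∃ b, b = (1 - σ) * α01 + σ * α11 := ⟨_, rfl⟩
  obtain ⟨p, hp⟩ : ∃ t, t = τ * (1 - σ) := ⟨_, rfl⟩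
  obtain ⟨q, hq⟩ : ∃ t, t = s * (1 - τ) := ⟨_, rfl⟩
  have hli := hlean i hi; have hlj := hlean j hj
  rw [← hbY, ← hbH] at hli hlj ⊢
  rw [← hp, ← hq]
  rw [← hbY] at hbY0; rw [← hbH] at hbH0; rw [← hp] at hp0; rw [← hq] at hq0
  obtain ⟨g, hgdef⟩ : ∃ t, t = c0 + p * bY + q * bH := ⟨_, rfl⟩
  rw [← hgdef]
  have hgpos : 0 < g := by rw [hgdef]; nlinarith [mul_pos hp0 hbY0, mul_pos hq0 hbH0]
  obtain ⟨ui, hui⟩ : ∃ t, t = (1 - s) * y i + s * k i - bY := ⟨_, rfl⟩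
  obtain ⟨uj, huj⟩ : ∃ t, t = (1 - s) * y j + s * k j - bY := ⟨_, rfl⟩
  obtain ⟨wi, hwi⟩ : ∃ t, t = (1 - σ) * gc i + σ * h i - bH := ⟨_, rfl⟩
  obtain ⟨wj, hwj⟩ : ∃ t, t = (1 - σ) * gc j + σ * h j - bH := ⟨_, rfl⟩
  rw [← hui, ← huj, ← hwi, ← hwj]
  rw [← hui, ← hwi] at hli; rw [← huj, ← hwj] at hlj
  have hui0 : 0 ≤ ui := by
    rw [hui, hbY]; nlinarith [mul_le_mul_of_nonneg_left (hy i hi) (sub_nonneg.2 hs1), mul_le_mul_of_nonneg_left (hk i hi) hs0.le]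
  have huj0 : 0 ≤ uj := by
    rw [huj, hbY]; nlinarith [mul_le_mul_of_nonneg_left (hy j hj) (sub_nonneg.2 hs1), mul_le_mul_of_nonneg_left (hk j hj) hs0.le]
  have hwi0 : 0 ≤ wi := by
    rw [hwi, hbH]; nlinarith [mul_le_mul_of_nonneg_left (hg i hi) (sub_nonneg.2 hσ1.le), mul_le_mul_of_nonneg_left (hh i hi) hσ0]
  have hwj0 : 0 ≤ wj := by
    rw [hwj, hbH]; nlinarith [mul_le_mul_of_nonneg_left (hg j hj) (sub_nonneg.2 hσ1.le), mul_le_mul_of_nonneg_left (hh j hj) hσ0]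
  -- normalised coordinates A = u/bY, B = w/bH (relative face excesses); same side: A ≥ B for both petals
  have hεsum : p * bY / g + q * bH / g ≤ 1 := by rw [← add_div, div_le_one hgpos, hgdef]; linarith
  have key := same_side_compat (ε₁ := p * bY / g) (ε₂ := q * bH / g) (A := ui / bY) (B := wi / bH) (A' := uj / bY) (B' := wj / bH)
    (div_nonneg (mul_nonneg hp0.le hbY0.le) hgpos.le) (div_nonneg (mul_nonneg hq0.le hbH0.le) hgpos.le) hεsum
    (div_nonneg hui0 hbY0.le) (div_nonneg hwi0 hbH0.le) (div_nonneg huj0 hbY0.le) (div_nonneg hwj0 hbH0.le)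
    (by
      have h1 : 0 ≤ ui / bY - wi / bH := by
        rw [sub_nonneg, div_le_div_iff₀ hbH0 hbY0]; linarith
      have h2 : 0 ≤ uj / bY - wj / bH := by
        rw [sub_nonneg, div_le_div_iff₀ hbH0 hbY0]; linarith
      exact mul_nonneg h1 h2)
  -- translate back
  have e1 : (p * bY / g * (ui / bY) + q * bH / g * (wi / bH)) * (p * bY / g * (uj / bY) + q * bH / g * (wj / bH)) =
      ((p * ui + q * wi) * (p * uj + q * wj)) / (g * g) := by field_simp
  have e2 : p * bY / g * (ui / bY * (uj / bY)) + q * bH / g * (wi / bH * (wj / bH)) =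
      (g * (p * (ui * uj) / bY + q * (wi * wj) / bH)) / (g * g) := by field_simp
  rw [e1, e2, div_le_div_iff_of_pos_right (mul_pos hgpos hgpos)] at key
  exact key

end Summit.CriticalPhenomena.PercolationContinuityZ3.Theorems.SunflowerPartition.SafeCalc.LinkedCurrency
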